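import Literature.Algebra.Homology.DoubleComplexZigzag
import Mathlib.RepresentationTheory.Homological.GroupCohomology.Basic
import Mathlib.RepresentationTheory.Invariants
import Mathlib.LinearAlgebra.Pi
import HarnessLib

/-!
# The double complex of inhomogeneous group cochains with values in an equivariant complex

The van Est / Čech–de Rham set-up as a CONCRETE anticommuting double complex (an instance of the
tree's `ADoubleComplex`, `DoubleComplexExactRows.lean`): for a group `Γ`, a commutative ring `k` and
an EQUIVARIANT COMPLEX of `k`-linear `Γ`-representations `(M r, ρ r, dM r : M r → M (r+1))`
(`dM ∘ dM = 0`, `dM` commutes with the action — `IsEquivariantComplex`),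

* `Cochain p r = (Fin p → Γ) → M r`, horizontal differential `δ r p` = Mathlib's inhomogeneous
  group-cochain differential of the representation `ρ r` (`groupCohomology.inhomogeneousCochains.d`,
  so `δ ∘ δ = 0` is Mathlib's), vertical differential `dC p r = (-1)ᵖ · (dM r ∘ ·)` (Weibel's sign
  trick); `doubleComplex` — the squares anticommute because `dM` is equivariant;
* the ROW augmentation by the invariants `(M r)^Γ` with the induced differential (`invAug`; it is
  exact: `invAug_exact` — the `δ`-closed `0`-cochains are the invariant elements), and the COLUMN
  augmentation by the inhomogeneous cochains with values in the constants `ker dM₀` (`constAug`,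
  `constAug_exact`);
* `colExact_of_exact` — if the coefficient complex is exact in positive degrees (a contracting
  homotopy of the coefficients, e.g. the cone/Poincaré homotopy of a growth class of forms on a
  convex cone) then the columns are exact; row exactness is the `Γ`-acyclicity of the coefficient
  modules in positive degrees (a partition-of-unity homotopy), taken as the hypothesis `RowExact`;
* **`exists_invariant_primitive`** — the injectivity statement: an invariant `dM`-closed
  `ω ∈ M (m+1)` whose class is killed by the comparison isomorphism `rowColEquiv` (e.g. at the top
  of a staircase whose bottom cocycle with values in the constants is a coboundary,
  `DoubleComplexStaircase.rowColEquiv_mk_eq_mk_of_staircase`) is `ω = dM ψ` with `ψ ∈ (M m)^Γ`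
  INVARIANT.

Pure algebra; definitions with bodies and theorems, no named fact, no `sorry`.
[cite: Weibel1994, Lemma 2.7.3] [cite: BottTu1982Forms, Prop. 9.5] [cite: Brown1982CohomologyGroups, III §1]

## References

* C. A. Weibel, *An Introduction to Homological Algebra* (1994), §1.2.5 (sign trick), Lemma 2.7.3,
  §6.5 (inhomogeneous cochains). [Weibel1994]
* R. Bott, L. W. Tu, *Differential Forms in Algebraic Topology* (1982), §8–9. [BottTu1982Forms]
* K. S. Brown, *Cohomology of Groups*, GTM 87 (1982), III §1. [Brown1982CohomologyGroups]
-/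

noncomputable section

open Function Literature.Algebra.Homology Literature.Algebra.Homology.ADoubleComplex

namespace Literature.Algebra.Homology

namespace GroupCochainDC

universe u

variable {k : Type u} [CommRing k] {Γ : Type u} [Group Γ]
  {M : ℕ → Type u} [∀ r, AddCommGroup (M r)] [∀ r, Module k (M r)]
  (ρ : ∀ r, Representation k Γ (M r)) (dM : ∀ r, M r →ₗ[k] M (r + 1))

/-- An **equivariant complex** of representations: `dM ∘ dM = 0` and `dM` commutes with the action.
[cite: Weibel1994, §6.5] -/
structure IsEquivariantComplex : Prop where
  /-- `dM ∘ dM = 0` -/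
  dM_dM : ∀ r (x : M r), dM (r + 1) (dM r x) = 0
  /-- `dM` is equivariant -/
  comm : ∀ r (g : Γ) (x : M r), dM r (ρ r g x) = ρ (r + 1) g (dM r x)

/-- The inhomogeneous `p`-cochains of `Γ` with values in `M r`. [cite: Brown1982CohomologyGroups, III §1] -/
abbrev Cochain (M : ℕ → Type u) (p r : ℕ) : Type u := (Fin p → Γ) → M r

/-! ### The horizontal differential: Mathlib's inhomogeneous group-cochain differential -/

/-- The inhomogeneous differential `δ : C^p(Γ, M r) → C^{p+1}(Γ, M r)` of the representation `ρ r`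
(Mathlib's `groupCohomology.inhomogeneousCochains.d`, as a linear map). [cite: Brown1982CohomologyGroups, III §1] -/
def δ (r p : ℕ) : Cochain (Γ := Γ) M p r →ₗ[k] Cochain (Γ := Γ) M (p + 1) r :=
  (inhomogeneousCochains.d (Rep.of (ρ r)) p).hom

/-- The formula: `(δ f)(g) = ρ(g₀) f(g₁, …) + ∑ⱼ (-1)^{j+1} f(…, gⱼ gⱼ₊₁, …)`. [cite: Brown1982CohomologyGroups, III §1] -/
theorem δ_apply (r p : ℕ) (f : Cochain (Γ := Γ) M p r) (g : Fin (p + 1) → Γ) :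
    δ ρ r p f g = ρ r (g 0) (f fun i => g i.succ) +
      Finset.univ.sum fun j : Fin (p + 1) => (-1 : k) ^ ((j : ℕ) + 1) • f (Fin.contractNth j (· * ·) g) := by
  rw [δ, inhomogeneousCochains.d_hom_apply, Rep.of_ρ]

/-- `δ ∘ δ = 0` (Mathlib). [cite: Brown1982CohomologyGroups, III §1] -/
theorem δ_δ (r p : ℕ) (f : Cochain (Γ := Γ) M p r) : δ ρ r (p + 1) (δ ρ r p f) = 0 := by
  have h := groupCohomology.inhomogeneousCochains.d_comp_d p (Rep.of (ρ r))
  have h' := congrArg (fun φ => φ.hom f) h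
  simp only [ModuleCat.hom_comp, LinearMap.comp_apply, ModuleCat.hom_zero, LinearMap.zero_apply] at h'
  exact h'

/-! ### The vertical differential: the coefficient differential with Weibel's sign -/

/-- The vertical differential `(-1)ᵖ · (dM r ∘ ·)` on `p`-cochains. [cite: Weibel1994, 1.2.5] -/
def dC (p r : ℕ) : Cochain (Γ := Γ) M p r →ₗ[k] Cochain (Γ := Γ) M p (r + 1) :=
  ((-1 : k) ^ p) • (dM r).compLeft (Fin p → Γ)

omit [Group Γ] in
/-- Unfolding. [folklore] -/
@[simp] theorem dC_apply (p r : ℕ) (f : Cochain (Γ := Γ) M p r) (g : Fin p → Γ) :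
    dC dM p r f g = ((-1 : k) ^ p) • dM r (f g) := rfl

variable {ρ dM}

/-- **The double complex of inhomogeneous cochains with values in an equivariant complex**
(anticommuting convention). [cite: Weibel1994, Lemma 2.7.3] -/
def doubleComplex (h : IsEquivariantComplex ρ dM) : ADoubleComplex k (fun p r => Cochain (Γ := Γ) M p r) where
  d p r := dC dM p r
  δ p r := δ ρ r p
  d_d p r f := by
    funext g
    simp only [dC_apply, map_smul, h.dM_dM, smul_zero, Pi.zero_apply]
  δ_δ p r f := δ_δ ρ r p f
  anticomm p r f := by
    funext g
    rw [Pi.add_apply, Pi.zero_apply]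
    set T : M (r + 1) := ρ (r + 1) (g 0) (dM r (f fun i => g i.succ)) +
      Finset.univ.sum fun j : Fin (p + 1) => (-1 : k) ^ ((j : ℕ) + 1) • dM r (f (Fin.contractNth j (· * ·) g))
      with hT
    have e1 : δ ρ (r + 1) p (dC dM p r f) g = ((-1 : k) ^ p) • T := by
      rw [δ_apply, hT, smul_add, Finset.smul_sum]
      congr 1
      · rw [dC_apply, map_smul]
      · refine Finset.sum_congr rfl fun j _ => ?_
        rw [dC_apply, smul_comm]
    have e2 : dC dM (p + 1) r (δ ρ r p f) g = -(((-1 : k) ^ p) • T) := by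
      rw [dC_apply, δ_apply]
      simp only [map_add, map_sum, map_smul, h.comm]
      rw [pow_succ, mul_smul, neg_one_smul, smul_neg]
    rw [e1, e2, add_neg_cancel]

/-- The entries of the double complex, unfolded. [folklore] -/
@[simp] theorem doubleComplex_d (h : IsEquivariantComplex ρ dM) (p r : ℕ) :
    (doubleComplex h).d p r = dC dM p r := rfl

/-- The entries of the double complex, unfolded. [folklore] -/
@[simp] theorem doubleComplex_δ (h : IsEquivariantComplex ρ dM) (p r : ℕ) :
    (doubleComplex h).δ p r = δ ρ r p := rfl

/-! ### The row augmentation by the invariants -/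

/-- `dM` maps invariants to invariants. [folklore] -/
theorem dM_mem_invariants (h : IsEquivariantComplex ρ dM) (r : ℕ) {x : M r} (hx : x ∈ (ρ r).invariants) :
    dM r x ∈ (ρ (r + 1)).invariants := by
  rw [Representation.mem_invariants] at hx ⊢
  intro g
  rw [← h.comm, hx g]

/-- The differential induced on the invariants. [folklore] -/
def dInv (h : IsEquivariantComplex ρ dM) (r : ℕ) : ↥(ρ r).invariants →ₗ[k] ↥(ρ (r + 1)).invariants :=
  (dM r).restrict fun _ hx => dM_mem_invariants h r hx

/-- Unfolding. [folklore] -/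
@[simp] theorem coe_dInv (h : IsEquivariantComplex ρ dM) (r : ℕ) (x : ↥(ρ r).invariants) :
    ((dInv h r x : ↥(ρ (r + 1)).invariants) : M (r + 1)) = dM r x := rfl

variable (ρ) in
/-- The augmentation `(M r)^Γ → C⁰(Γ, M r)`: an invariant element as a constant `0`-cochain. [folklore] -/
def εInv (r : ℕ) : ↥(ρ r).invariants →ₗ[k] Cochain (Γ := Γ) M 0 r where
  toFun x := fun _ => (x : M r)
  map_add' _ _ := rfl
  map_smul' _ _ := rfl

/-- Unfolding. [folklore] -/
@[simp] theorem εInv_apply (r : ℕ) (x : ↥(ρ r).invariants) (g : Fin 0 → Γ) : εInv ρ r x g = (x : M r) := rfl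

/-- The inhomogeneous differential of a `0`-cochain: `(δ f)(g) = ρ(g₀) f(·) - f(·)`. [cite: Brown1982CohomologyGroups, III §1] -/
theorem δ_zero_apply (r : ℕ) (f : Cochain (Γ := Γ) M 0 r) (g : Fin 1 → Γ) :
    δ ρ r 0 f g = ρ r (g 0) (f Fin.elim0) - f Fin.elim0 := by
  rw [δ_apply, Fin.sum_univ_one]
  have e1 : (fun i : Fin 0 => g i.succ) = Fin.elim0 := funext fun i => i.elim0
  have e2 : (Fin.contractNth 0 (· * ·) g : Fin 0 → Γ) = Fin.elim0 := funext fun i => i.elim0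
  rw [e1, e2]
  simp [sub_eq_add_neg]

/-- **The row augmentation by the invariants** `(M r)^Γ ↪ C⁰(Γ, M r)`. [cite: Weibel1994, Lemma 2.7.3] -/
def invAug (h : IsEquivariantComplex ρ dM) : (doubleComplex h).RowAugmentation (fun r => ↥(ρ r).invariants) where
  dA r := dInv h r
  ε r := εInv ρ r
  ε_dA r x := by
    funext g
    simp [doubleComplex, dC_apply]
  δ_ε r x := by
    funext g
    change δ ρ r 0 (εInv ρ r x) g = 0
    rw [δ_zero_apply]
    have hx := x.2
    rw [Representation.mem_invariants] at hx
    exact sub_eq_zero.2 (hx (g 0))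

/-- **The invariants augmentation is exact**: `ε` is injective and the `δ`-closed `0`-cochains are
exactly the invariant elements. [cite: Weibel1994, Lemma 2.7.3] -/
theorem invAug_exact (h : IsEquivariantComplex ρ dM) : (invAug h).Exact where
  injective r := by
    intro x y hxy
    have h0 := congrFun hxy Fin.elim0
    exact Subtype.ext h0
  exact r f hf := by
    have hf' : ∀ g : Fin 1 → Γ, δ ρ r 0 f g = 0 := fun g => congrFun hf g
    have hinv : f Fin.elim0 ∈ (ρ r).invariants := by
      rw [Representation.mem_invariants]
      intro γ
      have h1 := hf' (fun _ => γ)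
      rw [δ_zero_apply] at h1
      exact sub_eq_zero.1 h1
    refine ⟨⟨f Fin.elim0, hinv⟩, ?_⟩
    funext g
    have hg : g = Fin.elim0 := funext fun i => i.elim0
    subst hg
    rfl

/-! ### The column augmentation by the cochains with values in the constants `ker dM₀` -/

/-- The constants `ker dM₀ ≤ M 0` are stable under the action. [folklore] -/
theorem ρ_mem_ker (h : IsEquivariantComplex ρ dM) (g : Γ) {x : M 0} (hx : x ∈ LinearMap.ker (dM 0)) :
    ρ 0 g x ∈ LinearMap.ker (dM 0) := by
  rw [LinearMap.mem_ker] at hx ⊢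
  rw [h.comm, hx, map_zero]

/-- The representation on the constants `ker dM₀`. [folklore] -/
def ρKer (h : IsEquivariantComplex ρ dM) : Representation k Γ ↥(LinearMap.ker (dM 0)) where
  toFun g := (ρ 0 g).restrict fun _ hx => ρ_mem_ker h g hx
  map_one' := by ext x; simp
  map_mul' g g' := by ext x; simp

/-- Unfolding. [folklore] -/
@[simp] theorem coe_ρKer (h : IsEquivariantComplex ρ dM) (g : Γ) (x : ↥(LinearMap.ker (dM 0))) :
    ((ρKer h g x : ↥(LinearMap.ker (dM 0))) : M 0) = ρ 0 g x := rfl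

/-- The inhomogeneous cochains with values in the constants. [folklore] -/
abbrev KerCochain (dM : ∀ r, M r →ₗ[k] M (r + 1)) (p : ℕ) : Type u := (Fin p → Γ) → ↥(LinearMap.ker (dM 0))

/-- Their differential (Mathlib's inhomogeneous differential of `ρKer`). [cite: Brown1982CohomologyGroups, III §1] -/
def δKer (h : IsEquivariantComplex ρ dM) (p : ℕ) : KerCochain (Γ := Γ) dM p →ₗ[k] KerCochain (Γ := Γ) dM (p + 1) :=
  (inhomogeneousCochains.d (Rep.of (ρKer h)) p).hom

/-- The formula for `δKer`. [cite: Brown1982CohomologyGroups, III §1] -/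
theorem δKer_apply (h : IsEquivariantComplex ρ dM) (p : ℕ) (f : KerCochain (Γ := Γ) dM p) (g : Fin (p + 1) → Γ) :
    δKer h p f g = ρKer h (g 0) (f fun i => g i.succ) +
      Finset.univ.sum fun j : Fin (p + 1) => (-1 : k) ^ ((j : ℕ) + 1) • f (Fin.contractNth j (· * ·) g) := by
  rw [δKer, inhomogeneousCochains.d_hom_apply, Rep.of_ρ]

/-- The inclusion `C^p(Γ, ker dM₀) ↪ C^p(Γ, M 0)`. [folklore] -/
def ηKer (dM : ∀ r, M r →ₗ[k] M (r + 1)) (p : ℕ) : KerCochain (Γ := Γ) dM p →ₗ[k] Cochain (Γ := Γ) M p 0 :=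
  (LinearMap.ker (dM 0)).subtype.compLeft (Fin p → Γ)

omit [Group Γ] in
/-- Unfolding. [folklore] -/
@[simp] theorem ηKer_apply (p : ℕ) (f : KerCochain (Γ := Γ) dM p) (g : Fin p → Γ) : ηKer dM p f g = (f g : M 0) := rfl

/-- The inclusion commutes with the inhomogeneous differentials. [folklore] -/
theorem ηKer_δKer (h : IsEquivariantComplex ρ dM) (p : ℕ) (f : KerCochain (Γ := Γ) dM p) :
    ηKer dM (p + 1) (δKer h p f) = δ ρ 0 p (ηKer dM p f) := by
  funext g
  rw [ηKer_apply, δKer_apply, δ_apply, Submodule.coe_add, Submodule.coe_sum, coe_ρKer]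
  simp only [Submodule.coe_smul, ηKer_apply]

/-- **The column augmentation by the constants** `C^p(Γ, ker dM₀) ↪ C^p(Γ, M 0)`. [cite: Weibel1994, Lemma 2.7.3] -/
def constAug (h : IsEquivariantComplex ρ dM) : (doubleComplex h).ColAugmentation (fun p => KerCochain (Γ := Γ) dM p) where
  dA p := δKer h p
  ε p := ηKer dM p
  ε_dA p f := by
    change ηKer dM (p + 1) (δKer h p f) = δ ρ 0 p (ηKer dM p f)
    exact ηKer_δKer h p f
  δ_ε p f := by
    change dC dM p 0 (ηKer dM p f) = 0
    funext g
    rw [dC_apply, ηKer_apply, Pi.zero_apply]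
    have hf : dM 0 (f g : M 0) = 0 := (f g).2
    rw [hf, smul_zero]

/-- **The constants augmentation is exact**: `η` is injective and a `p`-cochain killed by the
vertical differential takes values in `ker dM₀`. [cite: Weibel1994, Lemma 2.7.3] -/
theorem constAug_exact (h : IsEquivariantComplex ρ dM) : (constAug h).Exact where
  injective p := by
    intro f f' hff'
    funext g
    exact Subtype.ext (congrFun hff' g)
  exact p F hF := by
    have hF' : ∀ g, dM 0 (F g) = 0 := by
      intro g
      have h1 : dC dM p 0 F g = 0 := congrFun hF g
      rw [dC_apply] at h1
      have hu : IsUnit ((-1 : k) ^ p) := (isUnit_one.neg).pow p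
      exact (hu.smul_eq_zero).1 h1
    exact ⟨fun g => ⟨F g, LinearMap.mem_ker.2 (hF' g)⟩, rfl⟩

/-! ### Exactness of the columns from exactness of the coefficients -/

/-- **Column exactness** from the exactness of the coefficient complex in positive degrees
(pointwise choice of primitives). [cite: Weibel1994, Lemma 2.7.3] -/
theorem colExact_of_exact (h : IsEquivariantComplex ρ dM)
    (hM : ∀ r (x : M (r + 1)), dM (r + 1) x = 0 → ∃ y : M r, dM r y = x) :
    (doubleComplex h).ColExact where
  exact p r F hF := by
    have hF' : ∀ g, dM (r + 1) (F g) = 0 := by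
      intro g
      have h1 : dC dM p (r + 1) F g = 0 := congrFun hF g
      rw [dC_apply] at h1
      exact (((isUnit_one.neg).pow p).smul_eq_zero).1 h1
    choose y hy using fun g => hM r (F g) (hF' g)
    refine ⟨fun g => ((-1 : k) ^ p) • y g, ?_⟩
    funext g
    change dC dM p r (fun g => ((-1 : k) ^ p) • y g) g = F g
    rw [dC_apply, map_smul, hy, smul_smul, ← pow_add, ← two_mul, pow_mul, neg_one_sq, one_pow, one_smul]

/-! ### Injectivity: invariant primitives -/

/-- **An invariant closed element whose class dies under the comparison is the differential of an
INVARIANT element.**  For the double complex of an equivariant complex with exact columns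
(`hM`) and exact rows (`hK`, the `Γ`-acyclicity of the coefficients), an invariant `dM`-closed
`ω ∈ M (m+1)` whose class is sent to `0` by `rowColEquiv` (e.g. by a staircase ending at a
coboundary, `DoubleComplexStaircase.rowColEquiv_mk_eq_mk_of_staircase`) is `dM ψ` with `ψ` invariant.
[cite: Weibel1994, Lemma 2.7.3] -/
theorem exists_invariant_primitive (h : IsEquivariantComplex ρ dM) (hK : (doubleComplex h).RowExact)
    (hM : ∀ r (x : M (r + 1)), dM (r + 1) x = 0 → ∃ y : M r, dM r y = x) {m : ℕ}
    (a : ↥(NatCochain.cocycles (invAug h).dA (m + 1)))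
    (ha : rowColEquiv (invAug h) (constAug h) hK (invAug_exact h) (colExact_of_exact h hM) (constAug_exact h)
      (m + 1) (NatCochain.Cohomology.mk (invAug h).dA (m + 1) a) = 0) :
    ∃ ψ : M m, ψ ∈ (ρ m).invariants ∧ dM m ψ = ((a : ↥(ρ (m + 1)).invariants) : M (m + 1)) := by
  have h0 : NatCochain.Cohomology.mk (invAug h).dA (m + 1) a = 0 := (LinearEquiv.map_eq_zero_iff _).1 ha
  rw [NatCochain.Cohomology.mk_eq_zero_iff, NatCochain.mem_coboundaries_succ_iff] at h0
  obtain ⟨ψ, hψ⟩ := h0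
  refine ⟨(ψ : M m), ψ.2, ?_⟩
  have h1 := congrArg (fun z : ↥(ρ (m + 1)).invariants => (z : M (m + 1))) hψ
  simpa [invAug] using h1

end GroupCochainDC

end Literature.Algebra.Homology

end
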